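import Mathlib
import Summits.Ventures.PercRepro2.ZMeanProof
import Summits.Ventures.PercRepro2.PendantRoot
import Summits.Ventures.PercRepro2.HMFLeaf
import Summits.Ventures.PercRepro2.HMFPendantRoot
import Summits.Ventures.PercRepro2.HMFTwoRootStar
import Summits.Ventures.PercRepro2.HMFTwoRootMass

/-!
# The two-root star at `a₃`: transport to the star-free world and the masses of `PD`, `T`, `T′`, `Q`
(blind cell PercRepro2, night-1 g6; exploration lens, NIGHT1-G6.md §7)

A probability under the pinned law `p[f₁ ↦ 0][f₂ ↦ 1]` of an event that agrees off `{both open}`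
with a star-free event is the `p`-probability of the latter (`prob_pinned`, `transport_h`,
`transport_l`); the masses of `PD = Q₀ ∩ {cc}`, `T = Q₀ ∩ {co}`, `T′ = Q₀ ∩ {oc}`, `Q = Q₀ ∩ {not both}`
intersected with a one-mark connection are the star-free masses times `(1−α)(1−β)`, `(1−α)β`,
`α(1−β)`, `1 − αβ` (`prob_PD_star_X` …); the residual world of the isolated leaf is the star-free
world (`connDelEvent_star`, `delQ_star`, `termW_leaf_star`).
-/

namespace Summit.Ventures.PercRepro2

open UnionCluster CovForm PendantRoot

namespace HMFTwoRoot

variable {V : Type*} {E : Type*} [Fintype E] [DecidableEq E] [Fintype V] [DecidableEq V]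
  {R : Type*} [Field R] [LinearOrder R] [IsStrictOrderedRing R]

/-! ## Transport to the star-free world; the identity; the theorem -/

section Main

variable (p : E → R) (ends : E → Sym2 V) {f₁ f₂ : E} {a₃ a₁ a₂ : V}

omit [Fintype V] [DecidableEq V] [LinearOrder R] [IsStrictOrderedRing R] in
/-- A probability under `p[f₁ ↦ 0][f₂ ↦ 1]` of an event that agrees off `{both open}` with a
star-free event `A₀` is the `p`-probability of `A₀`. -/
lemma prob_pinned (h12 : f₁ ≠ f₂) {A A₀ : Set (Config E)}
    (hA : ∀ ω : Config E, ¬ (ω f₁ = true ∧ ω f₂ = true) → (ω ∈ A ↔ ω ∈ A₀))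
    (hA₀ : DependsOn (· ∈ A₀) ({f₁, f₂}ᶜ : Set E)) :
    prob (Function.update (Function.update p f₁ 0) f₂ 1) A = prob p A₀ := by
  rw [prob_eq_expect_indicator, expect_update_one, expect_update_zero, prob_eq_expect_indicator]
  unfold expect
  refine Finset.sum_congr rfl fun ω _ => ?_
  dsimp only
  congr 1
  set ω' := Function.update (Function.update ω f₁ false) f₂ true with hω'
  have h1 : ω' f₁ = false := by
    rw [hω', Function.update_of_ne h12, Function.update_self]
  have hnb : ¬ (ω' f₁ = true ∧ ω' f₂ = true) := fun h => by rw [h.1] at h1; exact Bool.true_eq_false.mp h1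
  have hiff : ω' ∈ A ↔ ω ∈ A₀ := by
    rw [hA ω' hnb]
    refine dependsOn_mem_iff hA₀ fun e he => ?_
    have e1 : e ≠ f₁ := fun h => he (Set.mem_insert_iff.2 (Or.inl h))
    have e2 : e ≠ f₂ := fun h => he (Set.mem_insert_iff.2 (Or.inr h))
    rw [hω', Function.update_of_ne e2, Function.update_of_ne e1]
  by_cases h : ω ∈ A₀
  · rw [Set.indicator_of_mem (hiff.2 h), Set.indicator_of_mem h]
    rfl
  · rw [Set.indicator_of_notMem (fun h' => h (hiff.1 h')), Set.indicator_of_notMem h]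

omit [Fintype E] [Fintype V] [DecidableEq V] [LinearOrder R] [IsStrictOrderedRing R] in
/-- `connEvent₀` is symmetric. -/
lemma connEvent₀_comm (x v : V) : connEvent₀ ends f₁ f₂ x v = connEvent₀ ends f₁ f₂ v x := by
  ext ω; simp only [mem_connEvent₀]; exact ⟨conn_symm, conn_symm⟩

omit [Fintype E] [Fintype V] [DecidableEq V] [LinearOrder R] [IsStrictOrderedRing R] in
/-- Off `{both open}` the `Q`-complement event is `Q₀`. -/
lemma mem_Q_iff_Q₀ (hf₁ : ends f₁ = s(a₃, a₁)) (hf₂ : ends f₂ = s(a₃, a₂))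
    (hstar : ∀ e, a₃ ∈ ends e → e = f₁ ∨ e = f₂) (h31 : a₃ ≠ a₁) (h32 : a₃ ≠ a₂) {ω : Config E}
    (hnb : ¬ (ω f₁ = true ∧ ω f₂ = true)) :
    ω ∈ (connEvent ends a₂ a₁)ᶜ ↔ ω ∈ Q₀ ends f₁ f₂ a₁ a₂ := by
  simp only [Set.mem_compl_iff, connEvent, Set.mem_setOf_eq, Q₀, mem_connEvent₀]
  rw [conn_iff_closeStar hf₁ hf₂ hstar hnb (Ne.symm h32) (Ne.symm h31)]
  exact ⟨fun h h' => h (conn_symm h'), fun h h' => h (conn_symm h')⟩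

omit [Fintype E] [Fintype V] [DecidableEq V] [LinearOrder R] [IsStrictOrderedRing R] in
/-- Off `{both open}` a connection among non-`a₃` vertices is the star-free one (membership form). -/
lemma mem_conn_iff_conn₀ (hf₁ : ends f₁ = s(a₃, a₁)) (hf₂ : ends f₂ = s(a₃, a₂))
    (hstar : ∀ e, a₃ ∈ ends e → e = f₁ ∨ e = f₂) {x v : V} (hx : x ≠ a₃) (hv : v ≠ a₃)
    {ω : Config E} (hnb : ¬ (ω f₁ = true ∧ ω f₂ = true)) :
    ω ∈ connEvent ends x v ↔ ω ∈ connEvent₀ ends f₁ f₂ x v := by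
  simp only [connEvent, Set.mem_setOf_eq, mem_connEvent₀]
  exact conn_iff_closeStar hf₁ hf₂ hstar hnb hx hv

omit [Fintype E] [Fintype V] [DecidableEq V] [LinearOrder R] [IsStrictOrderedRing R] in
/-- Star-freeness of `Q₀ ∩ X₀`. -/
lemma dependsOn_Q₀_inter (a₁ a₂ : V) {X₀ : Set (Config E)}
    (hX : DependsOn (· ∈ X₀) ({f₁, f₂}ᶜ : Set E)) :
    DependsOn (· ∈ Q₀ ends f₁ f₂ a₁ a₂ ∩ X₀) ({f₁, f₂}ᶜ : Set E) := by
  have := dependsOn_inter (dependsOn_Q₀ (ends := ends) (f₁ := f₁) (f₂ := f₂) a₁ a₂) hX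
  rwa [Set.union_self] at this

omit [Fintype E] [Fintype V] [DecidableEq V] [LinearOrder R] [IsStrictOrderedRing R] in
/-- Star-freeness of `connEvent₀ x v ∩ connEvent₀ y w`. -/
lemma dependsOn_conn₀_inter (x v y w : V) :
    DependsOn (· ∈ connEvent₀ ends f₁ f₂ x v ∩ connEvent₀ ends f₁ f₂ y w) ({f₁, f₂}ᶜ : Set E) := by
  have := dependsOn_inter (dependsOn_connEvent₀ (ends := ends) (f₁ := f₁) (f₂ := f₂) x v)
    (dependsOn_connEvent₀ (ends := ends) (f₁ := f₁) (f₂ := f₂) y w)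
  rwa [Set.union_self] at this

/-! The masses of the star in the star-free world. -/

omit [Fintype V] [DecidableEq V] [LinearOrder R] [IsStrictOrderedRing R] in
/-- `P(Q₀ ∩ S ∩ X) = P((Q₀ ∩ X₀) ∩ S)` when `S ⊆ {not both open}`. -/
lemma prob_Q₀_state_inter (hf₁ : ends f₁ = s(a₃, a₁)) (hf₂ : ends f₂ = s(a₃, a₂))
    (hstar : ∀ e, a₃ ∈ ends e → e = f₁ ∨ e = f₂) {x v : V} (hx : x ≠ a₃) (hv : v ≠ a₃)
    (S : Set (Config E)) (hS : ∀ ω ∈ S, ¬ (ω f₁ = true ∧ ω f₂ = true)) :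
    prob p (Q₀ ends f₁ f₂ a₁ a₂ ∩ S ∩ connEvent ends x v) =
      prob p ((Q₀ ends f₁ f₂ a₁ a₂ ∩ connEvent₀ ends f₁ f₂ x v) ∩ S) := by
  congr 1
  ext ω
  simp only [Set.mem_inter_iff]
  constructor
  · rintro ⟨⟨hQ, hS'⟩, hX⟩
    exact ⟨⟨hQ, (mem_conn_iff_conn₀ ends hf₁ hf₂ hstar hx hv (hS ω hS')).1 hX⟩, hS'⟩
  · rintro ⟨⟨hQ, hX⟩, hS'⟩
    exact ⟨⟨hQ, hS'⟩, (mem_conn_iff_conn₀ ends hf₁ hf₂ hstar hx hv (hS ω hS')).2 hX⟩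

end Main

/-! The masses of `PD`, `T`, `T′`, `Q` in the star-free world. -/

section MassesStar

variable (p : E → R) (ends : E → Sym2 V) {f₁ f₂ : E} {a₃ a₁ a₂ : V}

omit [Fintype E] [DecidableEq E] [Fintype V] [DecidableEq V] [LinearOrder R] [IsStrictOrderedRing R] in
/-- Both star edges closed: not both open. -/
lemma nb_of_cc {ω : Config E} (hω : ω ∈ closedEdge f₁ ∩ closedEdge f₂) :
    ¬ (ω f₁ = true ∧ ω f₂ = true) := fun h => by
  have := mem_closedEdge.1 hω.1; rw [h.1] at this; exact Bool.true_eq_false.mp this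

omit [Fintype E] [DecidableEq E] [Fintype V] [DecidableEq V] [LinearOrder R] [IsStrictOrderedRing R] in
/-- `f₁` closed: not both open. -/
lemma nb_of_co {ω : Config E} (hω : ω ∈ closedEdge f₁ ∩ openEdge f₂) :
    ¬ (ω f₁ = true ∧ ω f₂ = true) := fun h => by
  have := mem_closedEdge.1 hω.1; rw [h.1] at this; exact Bool.true_eq_false.mp this

omit [Fintype E] [DecidableEq E] [Fintype V] [DecidableEq V] [LinearOrder R] [IsStrictOrderedRing R] in
/-- `f₂` closed: not both open. -/
lemma nb_of_oc {ω : Config E} (hω : ω ∈ openEdge f₁ ∩ closedEdge f₂) :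
    ¬ (ω f₁ = true ∧ ω f₂ = true) := fun h => by
  have := mem_closedEdge.1 hω.2; rw [h.2] at this; exact Bool.true_eq_false.mp this

omit [Fintype E] [DecidableEq E] [Fintype V] [DecidableEq V] [LinearOrder R] [IsStrictOrderedRing R] in
/-- One star edge closed: not both open. -/
lemma nb_of_nb {ω : Config E} (hω : ω ∈ closedEdge f₁ ∪ closedEdge f₂) :
    ¬ (ω f₁ = true ∧ ω f₂ = true) := fun h => by
  rcases hω with h1 | h2
  · have := mem_closedEdge.1 h1; rw [h.1] at this; exact Bool.true_eq_false.mp this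
  · have := mem_closedEdge.1 h2; rw [h.2] at this; exact Bool.true_eq_false.mp this

variable (hf₁ : ends f₁ = s(a₃, a₁)) (hf₂ : ends f₂ = s(a₃, a₂))
  (hstar : ∀ e, a₃ ∈ ends e → e = f₁ ∨ e = f₂) (h31 : a₃ ≠ a₁) (h32 : a₃ ≠ a₂) (h12 : f₁ ≠ f₂)

include hf₁ hf₂ hstar h31 h32 h12

omit [Fintype V] [DecidableEq V] [LinearOrder R] [IsStrictOrderedRing R] in
/-- `P(PD ∩ {x ↔ v}) = (1−α)(1−β) P(Q₀ ∩ {x ↔ v}₀)`. -/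
lemma prob_PD_star_X {x v : V} (hx : x ≠ a₃) (hv : v ≠ a₃) :
    prob p (PDEvent ends a₁ a₂ a₃ ∩ connEvent ends x v) =
      (1 - p f₁) * (1 - p f₂) * prob p (Q₀ ends f₁ f₂ a₁ a₂ ∩ connEvent₀ ends f₁ f₂ x v) := by
  rw [PDEvent_star hf₁ hf₂ hstar h31 h32,
    prob_Q₀_state_inter p ends hf₁ hf₂ hstar hx hv _ (fun _ hω => nb_of_cc hω),
    prob_inter_cc p h12 (dependsOn_Q₀_inter ends a₁ a₂ (dependsOn_connEvent₀ x v))]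

omit [Fintype V] [DecidableEq V] [LinearOrder R] [IsStrictOrderedRing R] in
/-- `P(T ∩ {x ↔ v}) = (1−α) β P(Q₀ ∩ {x ↔ v}₀)`. -/
lemma prob_T_star_X {x v : V} (hx : x ≠ a₃) (hv : v ≠ a₃) :
    prob p (TEvent ends a₁ a₂ a₃ ∩ connEvent ends x v) =
      (1 - p f₁) * p f₂ * prob p (Q₀ ends f₁ f₂ a₁ a₂ ∩ connEvent₀ ends f₁ f₂ x v) := by
  rw [TEvent_star hf₁ hf₂ hstar h31 h32,
    prob_Q₀_state_inter p ends hf₁ hf₂ hstar hx hv _ (fun _ hω => nb_of_co hω),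
    prob_inter_co p h12 (dependsOn_Q₀_inter ends a₁ a₂ (dependsOn_connEvent₀ x v))]

omit [Fintype V] [DecidableEq V] [LinearOrder R] [IsStrictOrderedRing R] in
/-- `P(T′ ∩ {x ↔ v}) = α (1−β) P(Q₀ ∩ {x ↔ v}₀)`. -/
lemma prob_T'_star_X {x v : V} (hx : x ≠ a₃) (hv : v ≠ a₃) :
    prob p (TEvent ends a₂ a₁ a₃ ∩ connEvent ends x v) =
      p f₁ * (1 - p f₂) * prob p (Q₀ ends f₁ f₂ a₁ a₂ ∩ connEvent₀ ends f₁ f₂ x v) := by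
  rw [TEvent'_star hf₁ hf₂ hstar h31 h32,
    prob_Q₀_state_inter p ends hf₁ hf₂ hstar hx hv _ (fun _ hω => nb_of_oc hω),
    prob_inter_oc p h12 (dependsOn_Q₀_inter ends a₁ a₂ (dependsOn_connEvent₀ x v))]

omit [Fintype V] [DecidableEq V] [LinearOrder R] [IsStrictOrderedRing R] in
/-- `P(Q ∩ {x ↔ v}) = (1 − αβ) P(Q₀ ∩ {x ↔ v}₀)`. -/
lemma prob_Q_star_X {x v : V} (hx : x ≠ a₃) (hv : v ≠ a₃) :
    prob p (avoidAll ends a₂ {a₁} ∩ connEvent ends x v) =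
      (1 - p f₁ * p f₂) * prob p (Q₀ ends f₁ f₂ a₁ a₂ ∩ connEvent₀ ends f₁ f₂ x v) := by
  rw [avoidAll_star hf₁ hf₂ hstar h31 h32,
    prob_Q₀_state_inter p ends hf₁ hf₂ hstar hx hv _ (fun _ hω => nb_of_nb hω),
    prob_inter_nb p h12 (dependsOn_Q₀_inter ends a₁ a₂ (dependsOn_connEvent₀ x v))]

omit [Fintype V] [DecidableEq V] [LinearOrder R] [IsStrictOrderedRing R] in
/-- `P(PD) = (1−α)(1−β) P(Q₀)`. -/
lemma prob_PD_star : prob p (PDEvent ends a₁ a₂ a₃) = (1 - p f₁) * (1 - p f₂) * prob p (Q₀ ends f₁ f₂ a₁ a₂) := by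
  rw [PDEvent_star hf₁ hf₂ hstar h31 h32, prob_inter_cc p h12 (dependsOn_Q₀ a₁ a₂)]

omit [Fintype V] [DecidableEq V] [LinearOrder R] [IsStrictOrderedRing R] in
/-- `P(T) = (1−α) β P(Q₀)`. -/
lemma prob_T_star : prob p (TEvent ends a₁ a₂ a₃) = (1 - p f₁) * p f₂ * prob p (Q₀ ends f₁ f₂ a₁ a₂) := by
  rw [TEvent_star hf₁ hf₂ hstar h31 h32, prob_inter_co p h12 (dependsOn_Q₀ a₁ a₂)]

omit [Fintype V] [DecidableEq V] [LinearOrder R] [IsStrictOrderedRing R] in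
/-- `P(T′) = α (1−β) P(Q₀)`. -/
lemma prob_T'_star : prob p (TEvent ends a₂ a₁ a₃) = p f₁ * (1 - p f₂) * prob p (Q₀ ends f₁ f₂ a₁ a₂) := by
  rw [TEvent'_star hf₁ hf₂ hstar h31 h32, prob_inter_oc p h12 (dependsOn_Q₀ a₁ a₂)]

omit [Fintype V] [DecidableEq V] [LinearOrder R] [IsStrictOrderedRing R] in
/-- `P(Q) = (1 − αβ) P(Q₀)`. -/
lemma prob_Q_star : prob p (avoidAll ends a₂ {a₁}) = (1 - p f₁ * p f₂) * prob p (Q₀ ends f₁ f₂ a₁ a₂) := by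
  rw [avoidAll_star hf₁ hf₂ hstar h31 h32, prob_inter_nb p h12 (dependsOn_Q₀ a₁ a₂)]

end MassesStar

/-! ## The isolated leaf, the transports, the identity and the theorem -/

section Final

variable (p : E → R) (ends : E → Sym2 V) {f₁ f₂ : E} {a₃ a₁ a₂ : V}

omit [Fintype E] [DecidableEq E] [Fintype V] [DecidableEq V] [LinearOrder R] [IsStrictOrderedRing R] in
/-- The edges touching `{a₃}` are the star edges. -/
lemma mem_touches_singleton_iff (hf₁ : ends f₁ = s(a₃, a₁)) (hf₂ : ends f₂ = s(a₃, a₂))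
    (hstar : ∀ e, a₃ ∈ ends e → e = f₁ ∨ e = f₂) (e : E) :
    e ∈ touches ends (↑({a₃} : Finset V) : Set V) ↔ e = f₁ ∨ e = f₂ := by
  simp only [mem_touches, Finset.coe_singleton, Set.mem_singleton_iff, exists_eq_left]
  constructor
  · rintro ⟨y, hy⟩; exact star_edge hstar hy
  · rintro (rfl | rfl)
    · exact ⟨a₁, hf₁⟩
    · exact ⟨a₂, hf₂⟩

omit [Fintype E] [LinearOrder R] [IsStrictOrderedRing R] in
/-- The residual connections of the isolated leaf are the star-free connections. -/
lemma connDelEvent_star (hf₁ : ends f₁ = s(a₃, a₁)) (hf₂ : ends f₂ = s(a₃, a₂))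
    (hstar : ∀ e, a₃ ∈ ends e → e = f₁ ∨ e = f₂) (x v : V) :
    connDelEvent ends ({a₃} : Finset V) x v = connEvent₀ ends f₁ f₂ x v := by
  ext ω
  simp only [mem_connDelEvent, mem_connEvent₀]
  have : restrict (touches ends (↑({a₃} : Finset V) : Set V))ᶜ ω = closeStar f₁ f₂ ω := by
    funext e
    by_cases e1 : e = f₁
    · rw [e1, restrict_apply_of_notMem (show f₁ ∉ (touches ends (↑({a₃} : Finset V) : Set V))ᶜ from
        fun h => h ((mem_touches_singleton_iff ends hf₁ hf₂ hstar f₁).2 (Or.inl rfl))),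
        closeStar_apply_f₁]
    by_cases e2 : e = f₂
    · rw [e2, restrict_apply_of_notMem (show f₂ ∉ (touches ends (↑({a₃} : Finset V) : Set V))ᶜ from
        fun h => h ((mem_touches_singleton_iff ends hf₁ hf₂ hstar f₂).2 (Or.inr rfl))),
        closeStar_apply_f₂]
    rw [restrict_apply_of_mem (show e ∈ (touches ends (↑({a₃} : Finset V) : Set V))ᶜ from fun h => by
        rcases (mem_touches_singleton_iff ends hf₁ hf₂ hstar e).1 h with h | h
        · exact e1 h
        · exact e2 h), closeStar_apply_of_ne e1 e2]
  rw [this]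

omit [Fintype E] [LinearOrder R] [IsStrictOrderedRing R] in
/-- The residual `Q` of the isolated leaf is `Q₀`. -/
lemma delQ_star (hf₁ : ends f₁ = s(a₃, a₁)) (hf₂ : ends f₂ = s(a₃, a₂))
    (hstar : ∀ e, a₃ ∈ ends e → e = f₁ ∨ e = f₂) :
    delQ ends ({a₃} : Finset V) a₁ a₂ = Q₀ ends f₁ f₂ a₁ a₂ := by
  rw [delQ, connDelEvent_star ends hf₁ hf₂ hstar]; rfl

/-- `P(Q₀) · termW({a₃}) = P(Q₀,oL) P(Q₀,bH) + P(Q₀,oH) P(Q₀,bL)` in the star-free world. -/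
lemma termW_leaf_star (hp : IsProbVec p) (hf₁ : ends f₁ = s(a₃, a₁)) (hf₂ : ends f₂ = s(a₃, a₂))
    (hstar : ∀ e, a₃ ∈ ends e → e = f₁ ∨ e = f₂) (h31 : a₃ ≠ a₁) (h32 : a₃ ≠ a₂) {o b : V}
    (ho : o ≠ a₃) (hb : b ≠ a₃) :
    prob p (Q₀ ends f₁ f₂ a₁ a₂) * termW p ends o a₁ a₂ b {a₃} =
      prob p (Q₀ ends f₁ f₂ a₁ a₂ ∩ connEvent₀ ends f₁ f₂ a₁ o) *
          prob p (Q₀ ends f₁ f₂ a₁ a₂ ∩ connEvent₀ ends f₁ f₂ a₂ b) +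
        prob p (Q₀ ends f₁ f₂ a₁ a₂ ∩ connEvent₀ ends f₁ f₂ a₂ o) *
          prob p (Q₀ ends f₁ f₂ a₁ a₂ ∩ connEvent₀ ends f₁ f₂ a₁ b) := by
  have h1 : a₁ ∉ ({a₃} : Finset V) := by simp [Ne.symm h31]
  have h2 : a₂ ∉ ({a₃} : Finset V) := by simp [Ne.symm h32]
  have ho' : o ∉ ({a₃} : Finset V) := by simp [ho]
  have hb' : b ∉ ({a₃} : Finset V) := by simp [hb]
  simp only [termW, h1, h2, if_false, termPD, delShareMass, ho', hb', delQ_star ends hf₁ hf₂ hstar,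
    connDelEvent_star ends hf₁ hf₂ hstar]
  by_cases hZ : prob p (Q₀ ends f₁ f₂ a₁ a₂) = 0
  · have hmono : ∀ X, prob p (Q₀ ends f₁ f₂ a₁ a₂ ∩ X) = 0 := fun X =>
      le_antisymm (by rw [← hZ]; exact prob_mono hp Set.inter_subset_left) (prob_nonneg hp _)
    simp [hZ, hmono]
  · rw [mul_div_cancel₀ _ hZ]

variable (hf₁ : ends f₁ = s(a₃, a₁)) (hf₂ : ends f₂ = s(a₃, a₂))
  (hstar : ∀ e, a₃ ∈ ends e → e = f₁ ∨ e = f₂) (h31 : a₃ ≠ a₁) (h32 : a₃ ≠ a₂) (h12 : f₁ ≠ f₂)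

include hf₁ hf₂ hstar h31 h32 h12

omit [Fintype V] [DecidableEq V] [LinearOrder R] [IsStrictOrderedRing R] in
/-- Transport of a heavy-world probability `P_{p[f₁↦0][f₂↦1]}(X ∩ Q)` to the star-free world. -/
lemma transport_h {X X₀ : Set (Config E)}
    (hX : ∀ ω : Config E, ¬ (ω f₁ = true ∧ ω f₂ = true) → (ω ∈ X ↔ ω ∈ X₀))
    (hX₀ : DependsOn (· ∈ X₀) ({f₁, f₂}ᶜ : Set E)) :
    prob (Function.update (Function.update p f₁ 0) f₂ 1) (X ∩ (connEvent ends a₂ a₁)ᶜ) =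
      prob p (Q₀ ends f₁ f₂ a₁ a₂ ∩ X₀) := by
  refine prob_pinned p h12 (fun ω hnb => ?_) (dependsOn_Q₀_inter ends a₁ a₂ hX₀)
  simp only [Set.mem_inter_iff]
  rw [hX ω hnb, mem_Q_iff_Q₀ ends hf₁ hf₂ hstar h31 h32 hnb]
  exact and_comm

omit [Fintype V] [DecidableEq V] [LinearOrder R] [IsStrictOrderedRing R] in
/-- Transport of the heavy-world `P(Q)`. -/
lemma transport_h_Q :
    prob (Function.update (Function.update p f₁ 0) f₂ 1) (connEvent ends a₂ a₁)ᶜ =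
      prob p (Q₀ ends f₁ f₂ a₁ a₂) :=
  prob_pinned p h12 (fun _ hnb => mem_Q_iff_Q₀ ends hf₁ hf₂ hstar h31 h32 hnb) (dependsOn_Q₀ a₁ a₂)

omit [Fintype V] [DecidableEq V] [LinearOrder R] [IsStrictOrderedRing R] in
/-- Transport of a light-world probability `P_{p[f₂↦0][f₁↦1]}(X ∩ Q)` to the star-free world. -/
lemma transport_l {X X₀ : Set (Config E)}
    (hX : ∀ ω : Config E, ¬ (ω f₁ = true ∧ ω f₂ = true) → (ω ∈ X ↔ ω ∈ X₀))
    (hX₀ : DependsOn (· ∈ X₀) ({f₁, f₂}ᶜ : Set E)) :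
    prob (Function.update (Function.update p f₂ 0) f₁ 1) (X ∩ (connEvent ends a₁ a₂)ᶜ) =
      prob p (Q₀ ends f₁ f₂ a₁ a₂ ∩ X₀) := by
  have hX₀' : DependsOn (· ∈ Q₀ ends f₁ f₂ a₁ a₂ ∩ X₀) ({f₂, f₁}ᶜ : Set E) := by
    rw [Set.pair_comm]; exact dependsOn_Q₀_inter ends a₁ a₂ hX₀
  refine prob_pinned p (Ne.symm h12) (fun ω hnb => ?_) hX₀'
  have hnb' : ¬ (ω f₁ = true ∧ ω f₂ = true) := fun h => hnb ⟨h.2, h.1⟩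
  simp only [Set.mem_inter_iff]
  rw [hX ω hnb', connEvent_comm ends a₁ a₂, mem_Q_iff_Q₀ ends hf₁ hf₂ hstar h31 h32 hnb']
  exact and_comm

omit [Fintype V] [DecidableEq V] [LinearOrder R] [IsStrictOrderedRing R] in
/-- Transport of the light-world `P(Q)`. -/
lemma transport_l_Q :
    prob (Function.update (Function.update p f₂ 0) f₁ 1) (connEvent ends a₁ a₂)ᶜ =
      prob p (Q₀ ends f₁ f₂ a₁ a₂) := by
  have h := prob_pinned p (Ne.symm h12) (A := (connEvent ends a₁ a₂)ᶜ) (A₀ := Q₀ ends f₁ f₂ a₁ a₂)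
    (fun ω hnb => by
      have hnb' : ¬ (ω f₁ = true ∧ ω f₂ = true) := fun h => hnb ⟨h.2, h.1⟩
      rw [connEvent_comm ends a₁ a₂]
      exact mem_Q_iff_Q₀ ends hf₁ hf₂ hstar h31 h32 hnb')
    (by rw [Set.pair_comm]; exact dependsOn_Q₀ a₁ a₂)
  exact h

omit [Fintype E] [Fintype V] [DecidableEq V] [LinearOrder R] [IsStrictOrderedRing R] h31 h32 h12 in
/-- Pointwise: a two-mark event agrees with its star-free version off `{both open}`. -/
lemma mem_two_iff {x v y w : V} (hx : x ≠ a₃) (hv : v ≠ a₃) (hy : y ≠ a₃) (hw : w ≠ a₃)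
    {ω : Config E} (hnb : ¬ (ω f₁ = true ∧ ω f₂ = true)) :
    ω ∈ connEvent ends x v ∩ connEvent ends y w ↔
      ω ∈ connEvent₀ ends f₁ f₂ x v ∩ connEvent₀ ends f₁ f₂ y w := by
  simp only [Set.mem_inter_iff]
  rw [mem_conn_iff_conn₀ ends hf₁ hf₂ hstar hx hv hnb, mem_conn_iff_conn₀ ends hf₁ hf₂ hstar hy hw hnb]

end Final

end HMFTwoRoot

end Summit.Ventures.PercRepro2
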